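import Mathlib
import Summits.NavierStokesRegularity.NavierStokesRegularity.Theorems.TypeIQuarterGateScarEnvelopeTypeIZoomDictionaryDefs

/-!
# Parts B–C (tree-currency part) + Part D set-up: elementary lemmas, slices, rescaling, unit normalisation constants

Parts B1/B3 of the plate (window radius `R₀`, `norm_le_of_ae_of_continuousOn`, continuity/measurability of zooms, the slice lemmas: Fubini a.e.-measurability `ae_slice_aemeasurable` and a.e. convergence of slices along a subsequence `exists_subseq_ae_slice_tendsto` by Tonelli + `2⁻ⁿ` extraction), the kept part of Part C (`zoom_scale` covariances) and the set-up of Part D (`ν = 1`, zoom at scale `c₀ℓ`, cylinder inclusions).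

PROVENANCE: declaration texts VERBATIM from the HOME plate `round-31/Tangent31prep.lean` v4 (sha16
`013b26365b5cdf0a`, + K12 of v5 `e5b8668e3a090216`; = ROUND-30 plate v10 + Part K) of the instrument seat nsreg-p3 (g24/g25, cell
`pub/ns-regularity-ideate`), who cannot write under `Theorems/` (`perm.theorems-prover-only`); landed by the
LEAD-lineage prover ns-sz-p1 g5 on director-ns DIRECTOR-NS #218 (2), split into ≤ 400-line modules (the
plate's `def`s gathered in `TypeIQuarterGateScarEnvelopeTypeIZoomDictionaryDefs`), namespace
`Summit.NavierStokesRegularity.NavierStokesRegularity.Cruxes.ScarEnvelopeTypeI.ZoomDictionary` (the plate's `NsregP3.R30P`), `E3` spelled out, one-line docstrings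
added where the plate had none.  `--supports stmt-NavierStokesRegularity-23843 --as helper`.

HONEST FRAMING: dictionary / census TOOLING for the crux `TypeIQuarterGate.ScarEnvelopeTypeI` (item 23843):
equivalences and normal forms, kernel-checked; NO open statement is proved — 23843, its parent
`QuarterLawTypeI` (23726), the route and Navier–Stokes regularity are OPEN; hard core evaded: none.
-/

-- the summit-side namespace repeats a component by design (single-conjunct summit, D-0017)
set_option linter.dupNamespace false

open MeasureTheory Set Metric Filter Topology
open scoped ENNReal

namespace Summit.NavierStokesRegularity.NavierStokesRegularity.Cruxes.ScarEnvelopeTypeI.ZoomDictionary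

variable {u : ℝ → (EuclideanSpace ℝ (Fin 3)) → (EuclideanSpace ℝ (Fin 3))} {a : (EuclideanSpace ℝ (Fin 3))} {ν T : ℝ}

/-! # Part B — concrete tangent flows and the three print facts

## B1. Objects -/

/-- `3e ≤ R₀ ν`. [folklore] -/
theorem R₀_ge (ν : ℝ) : 3 * Real.exp 1 ≤ R₀ ν := by
  have := Real.sqrt_nonneg (2 / ν); simp only [R₀]; linarith

/-- `0 < R₀ ν`. [folklore] -/
theorem R₀_pos (ν : ℝ) : 0 < R₀ ν := lt_of_lt_of_le (by positivity) (R₀_ge ν)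

section Lemmas

variable {u : ℝ → (EuclideanSpace ℝ (Fin 3)) → (EuclideanSpace ℝ (Fin 3))} {a : (EuclideanSpace ℝ (Fin 3))} {T : ℝ}

/-- A continuous function a.e. bounded on an open set is bounded there pointwise. -/
theorem norm_le_of_ae_of_continuousOn {f : ℝ × (EuclideanSpace ℝ (Fin 3)) → (EuclideanSpace ℝ (Fin 3))} {U : Set (ℝ × (EuclideanSpace ℝ (Fin 3)))} (hU : IsOpen U)
    (hf : ContinuousOn f U) {M : ℝ} (h : ∀ᵐ z ∂(volume.restrict U), ‖f z‖ ≤ M) :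
    ∀ z ∈ U, ‖f z‖ ≤ M := by
  by_contra hcon
  push Not at hcon
  obtain ⟨z, hzU, hzM⟩ := hcon
  set O : Set (ℝ × (EuclideanSpace ℝ (Fin 3))) := U ∩ (fun w => ‖f w‖) ⁻¹' Ioi M with hO
  have hOopen : IsOpen O := (hf.norm).isOpen_inter_preimage hU isOpen_Ioi
  have hzO : z ∈ O := ⟨hzU, hzM⟩
  have hpos : 0 < volume O := hOopen.measure_pos volume ⟨z, hzO⟩
  have hnull : volume O = 0 := by
    have h' : ∀ᵐ w ∂volume, w ∈ U → ‖f w‖ ≤ M := (ae_restrict_iff' hU.measurableSet).1 h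
    have h0 : volume {w | ¬ (w ∈ U → ‖f w‖ ≤ M)} = 0 := ae_iff.1 h'
    refine measure_mono_null (fun w hw => ?_) h0
    simp only [mem_setOf_eq]
    exact fun himp => absurd (himp hw.1) (not_le.2 hw.2)
  exact absurd hnull hpos.ne'

/-- The zooms are continuous on backward cylinders `(-r², 0) × B_r(y)` with `ℓ² r² < T` when `u` is
continuous on the open strip `(0,T) × ℝ³` (no regularity of `u` is assumed outside it: before `0`
and after `T` the values of `u` are junk). -/
theorem continuousOn_zoom (hcont : ContinuousOn (Function.uncurry u) (Ioo 0 T ×ˢ univ)) {ℓ : ℝ}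
    (hℓ : 0 < ℓ) (y : (EuclideanSpace ℝ (Fin 3))) {r : ℝ} (hℓT : ℓ ^ 2 * r ^ 2 < T) :
    ContinuousOn (Function.uncurry (zoom u a T ℓ)) ((Ioo (-(r ^ 2)) 0 ×ˢ ball y r)) := by
  have hΨ : Continuous (fun z : ℝ × (EuclideanSpace ℝ (Fin 3)) => (T + ℓ ^ 2 * z.1, a + ℓ • z.2)) := by fun_prop
  have hmaps : MapsTo (fun z : ℝ × (EuclideanSpace ℝ (Fin 3)) => (T + ℓ ^ 2 * z.1, a + ℓ • z.2)) ((Ioo (-(r ^ 2)) 0 ×ˢ ball y r))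
      (Ioo 0 T ×ˢ univ) := by
    intro z hz
    simp only [mem_prod, mem_Ioo] at hz
    refine ⟨⟨?_, ?_⟩, mem_univ _⟩
    · nlinarith [hz.1.1, pow_pos hℓ 2]
    · nlinarith [hz.1.2, pow_pos hℓ 2]
  have h := (hcont.comp hΨ.continuousOn hmaps).const_smul ℓ
  refine h.congr fun z _ => ?_
  simp [zoom, Function.uncurry, Function.comp]

/-- Time slices of the zooms at times `s < 0` with `T + ℓ² s > 0` are continuous, hence measurable,
when `u` is continuous on the open strip. -/
theorem continuous_zoom_slice (hcont : ContinuousOn (Function.uncurry u) (Ioo 0 T ×ˢ univ))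
    {ℓ s : ℝ} (hℓ : 0 < ℓ) (hs : s < 0) (hsT : 0 < T + ℓ ^ 2 * s) :
    Continuous (fun x : (EuclideanSpace ℝ (Fin 3)) => zoom u a T ℓ s x) := by
  have hΨ : Continuous (fun x : (EuclideanSpace ℝ (Fin 3)) => (T + ℓ ^ 2 * s, a + ℓ • x)) := by fun_prop
  have hmaps : ∀ x : (EuclideanSpace ℝ (Fin 3)), (T + ℓ ^ 2 * s, a + ℓ • x) ∈ Ioo 0 T ×ˢ (univ : Set (EuclideanSpace ℝ (Fin 3))) := by
    intro x
    refine ⟨⟨hsT, ?_⟩, mem_univ _⟩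
    nlinarith [pow_pos hℓ 2]
  have h := (hcont.comp_continuous hΨ hmaps).const_smul ℓ
  refine h.congr fun x => ?_
  simp [zoom, Function.uncurry, Function.comp]

/-- Slices of the zoom of a field continuous on the open strip are measurable (at physical times). [folklore] -/
theorem measurable_zoom_slice (hcont : ContinuousOn (Function.uncurry u) (Ioo 0 T ×ˢ univ))
    {ℓ s : ℝ} (hℓ : 0 < ℓ) (hs : s < 0) (hsT : 0 < T + ℓ ^ 2 * s) :
    Measurable (fun x : (EuclideanSpace ℝ (Fin 3)) => zoom u a T ℓ s x) :=
  (continuous_zoom_slice hcont hℓ hs hsT).measurable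

/-- Along positive null scales, eventually `ℓ_k² < T`. -/
theorem eventually_sq_lt {ℓ : ℕ → ℝ} (hlim : Tendsto ℓ atTop (𝓝 0)) (hT : 0 < T) :
    ∀ᶠ k in atTop, ℓ k ^ 2 < T := by
  have h : Tendsto (fun k => ℓ k ^ 2) atTop (𝓝 0) := by simpa using hlim.pow 2
  exact (tendsto_order.1 h).2 T hT

/-- Numerics of `e`. -/
theorem exp_one_gt : (2.7 : ℝ) < Real.exp 1 := lt_trans (by norm_num) Real.exp_one_gt_d9
/-- `e < 2.72`. [folklore] -/
theorem exp_one_lt : Real.exp 1 < (2.72 : ℝ) := lt_trans Real.exp_one_lt_d9 (by norm_num)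

/-- The quarter ball around a point of the closed unit annulus is covered by two octave annuli
of radii `1/2` and `13/10` (both in `[1/2, 2]`). -/
theorem ball_subset_two_octAnn {y : (EuclideanSpace ℝ (Fin 3))} (hy : y ∈ unitAnn) :
    ball y (1 / 4) ⊆ octAnn (0 : (EuclideanSpace ℝ (Fin 3))) (1 / 2) ∪ octAnn (0 : (EuclideanSpace ℝ (Fin 3))) (13 / 10) := by
  intro z hz
  rw [mem_ball, dist_eq_norm] at hz
  obtain ⟨hy1, hy2⟩ : 1 ≤ ‖y‖ ∧ ‖y‖ ≤ Real.exp 1 := by simpa [unitAnn] using hy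
  have h1 : ‖y‖ - 1 / 4 < ‖z‖ := by
    have := norm_sub_norm_le y z; rw [norm_sub_rev] at hz; linarith
  have h2 : ‖z‖ < ‖y‖ + 1 / 4 := by
    have := norm_sub_norm_le z y; linarith
  have he1 := exp_one_gt; have he2 := exp_one_lt
  simp only [octAnn, mem_union, mem_setOf_eq, sub_zero]
  by_cases hc : ‖z‖ < Real.exp 1 * (1 / 2)
  · exact Or.inl ⟨by linarith, hc⟩
  · push Not at hc
    exact Or.inr ⟨by nlinarith, by nlinarith⟩

/-! ### Slices: a.e.-measurability (Fubini) and a.e. convergence along a subsequence -/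

/-- Lebesgue measure on `ℝ × E3` restricted to a product set is the product of the restrictions. [folklore] -/
theorem volume_restrict_prod_eq (I : Set ℝ) (B : Set (EuclideanSpace ℝ (Fin 3))) :
    (volume.restrict (I ×ˢ B) : Measure (ℝ × (EuclideanSpace ℝ (Fin 3)))) =
      (volume.restrict I).prod (volume.restrict B) := by
  rw [Measure.prod_restrict, ← Measure.volume_eq_prod]

/-- A.e. time slice of an a.e.-strongly-measurable space–time field is a.e.-measurable (Fubini). -/
theorem ae_slice_aemeasurable {I : Set ℝ} {B : Set (EuclideanSpace ℝ (Fin 3))} {v : ℝ → (EuclideanSpace ℝ (Fin 3)) → (EuclideanSpace ℝ (Fin 3))}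
    (hv : AEStronglyMeasurable (Function.uncurry v) (volume.restrict (I ×ˢ B))) :
    ∀ᵐ s ∂(volume.restrict I), AEMeasurable (fun x => v s x) (volume.restrict B) := by
  rw [volume_restrict_prod_eq] at hv
  filter_upwards [hv.prodMk_left] with s hs
  exact hs.aemeasurable

/-- **Slice-wise a.e. convergence along a subsequence.** If `∫∫_{I × B} F_k → 0` (and the `F_k` are
eventually a.e.-measurable), then along some subsequence `∫_B F_{φ k}(s, ·) → 0` for a.e. `s ∈ I`
(Tonelli + a `2⁻ⁿ` extraction + Borel–Cantelli in the form `∑ < ∞ ⇒ terms → 0`). -/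
theorem exists_subseq_ae_slice_tendsto {I : Set ℝ} {B : Set (EuclideanSpace ℝ (Fin 3))} {F : ℕ → ℝ × (EuclideanSpace ℝ (Fin 3)) → ℝ≥0∞}
    (hF : ∀ᶠ k in atTop, AEMeasurable (F k) (volume.restrict (I ×ˢ B)))
    (h : Tendsto (fun k => ∫⁻ z in I ×ˢ B, F k z) atTop (𝓝 0)) :
    ∃ φ : ℕ → ℕ, StrictMono φ ∧ ∀ᵐ s ∂(volume.restrict I),
      Tendsto (fun k => ∫⁻ x in B, F (φ k) (s, x)) atTop (𝓝 0) := by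
  have hμ := volume_restrict_prod_eq I B
  have hev : ∀ n : ℕ, ∀ᶠ k in atTop, AEMeasurable (F k) ((volume.restrict I).prod (volume.restrict B)) ∧
      ∫⁻ s in I, ∫⁻ x in B, F k (s, x) ≤ (2⁻¹ : ℝ≥0∞) ^ n := by
    intro n
    have hpos : (0 : ℝ≥0∞) < 2⁻¹ ^ n := ENNReal.pow_pos (by norm_num) n
    filter_upwards [hF, (tendsto_order.1 h).2 _ hpos] with k hk hkn
    have hk' : AEMeasurable (F k) ((volume.restrict I).prod (volume.restrict B)) := by
      rw [← hμ]; exact hk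
    refine ⟨hk', ?_⟩
    rw [← lintegral_prod _ hk', ← hμ]
    exact hkn.le
  obtain ⟨φ, hφ, hφb⟩ := extraction_forall_of_eventually hev
  refine ⟨φ, hφ, ?_⟩
  have hg : ∀ n, AEMeasurable (fun s => ∫⁻ x in B, F (φ n) (s, x)) (volume.restrict I) :=
    fun n => (hφb n).1.lintegral_prod_right'
  have hsum : ∫⁻ s in I, ∑' n, ∫⁻ x in B, F (φ n) (s, x) ≠ ⊤ := by
    rw [lintegral_tsum fun n => hg n]
    refine ne_top_of_le_ne_top ?_ (ENNReal.tsum_le_tsum fun n => (hφb n).2)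
    rw [ENNReal.tsum_geometric, ENNReal.one_sub_inv_two, inv_inv]
    exact ENNReal.ofNat_ne_top
  filter_upwards [ae_lt_top' (AEMeasurable.tsum hg) hsum] with s hs
  exact ENNReal.tendsto_atTop_zero_of_tsum_ne_top hs.ne

/-- Along positive null scales, eventually `ℓ_k² c < T` (any fixed `c`). -/
theorem eventually_sq_mul_lt {T : ℝ} {ℓ : ℕ → ℝ} (hlim : Tendsto ℓ atTop (𝓝 0)) (hT : 0 < T)
    (c : ℝ) : ∀ᶠ k in atTop, ℓ k ^ 2 * c < T := by
  have h : Tendsto (fun k => ℓ k ^ 2 * c) atTop (𝓝 0) := by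
    simpa using (hlim.pow 2).mul_const c
  exact (tendsto_order.1 h).2 T hT

end Lemmas

section Derivations

variable {u : ℝ → (EuclideanSpace ℝ (Fin 3)) → (EuclideanSpace ℝ (Fin 3))} {p : ℝ → (EuclideanSpace ℝ (Fin 3)) → ℝ} {a : (EuclideanSpace ℝ (Fin 3))} {ν T : ℝ}

end Derivations

section Rescaling

open Literature.Analysis.FluidPDE

variable {u : ℝ → (EuclideanSpace ℝ (Fin 3)) → (EuclideanSpace ℝ (Fin 3))} {p : ℝ → (EuclideanSpace ℝ (Fin 3)) → ℝ} {a : (EuclideanSpace ℝ (Fin 3))} {ν T : ℝ}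

/-- A classical solution on `[0,T)` is continuous on the open strip. -/
theorem continuousOn_of_classical (hsol : IsClassicalNSSolutionOn (Ico 0 T) ν 0 u p) :
    ContinuousOn (Function.uncurry u) (Ioo 0 T ×ˢ univ) :=
  hsol.smooth_velocity.continuousOn.mono (prod_mono Ioo_subset_Ico_self subset_rfl)

end Rescaling

section UnitNormalisation

open Literature.Analysis.FluidPDE

variable {u : ℝ → (EuclideanSpace ℝ (Fin 3)) → (EuclideanSpace ℝ (Fin 3))} {p : ℝ → (EuclideanSpace ℝ (Fin 3)) → ℝ} {a : (EuclideanSpace ℝ (Fin 3))} {T : ℝ}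

/-- `0 < c₀`. [folklore] -/
theorem c₀_pos : 0 < c₀ := mul_pos two_pos (R₀_pos 1)

/-- `16 < c₀` (so the scale-`ℓ` window sits inside `Q_{1/2}(0)` after zooming at scale `c₀ℓ`). [folklore] -/
theorem sixteen_lt_c₀ : 16 < c₀ := by
  have h := R₀_ge 1
  have he := exp_one_gt
  show 16 < 2 * R₀ 1
  linarith

/-- Composition of zooms with a fixed factor: `u^{(cℓ)}(s, x) = c · u^{(ℓ)}(c² s, c x)`. -/
theorem zoom_mul (u : ℝ → (EuclideanSpace ℝ (Fin 3)) → (EuclideanSpace ℝ (Fin 3))) (a : (EuclideanSpace ℝ (Fin 3))) (T ℓ c s : ℝ) (x : (EuclideanSpace ℝ (Fin 3))) :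
    zoom u a T (c * ℓ) s x = c • zoom u a T ℓ (c ^ 2 * s) (c • x) := by
  have h1 : T + (c * ℓ) ^ 2 * s = T + ℓ ^ 2 * (c ^ 2 * s) := by ring
  have h2 : a + (c * ℓ) • x = a + ℓ • (c • x) := by rw [smul_smul, mul_comm]
  unfold zoom
  rw [h1, h2]
  exact mul_smul c ℓ _

/-- Zooms at scales `ℓ` and `cℓ` differ by the parabolic similarity of ratio `c`. [folklore] -/
theorem zoom_eq_inv_smul_zoom_mul {c : ℝ} (hc : c ≠ 0) (u : ℝ → (EuclideanSpace ℝ (Fin 3)) → (EuclideanSpace ℝ (Fin 3))) (a : (EuclideanSpace ℝ (Fin 3))) (T ℓ s : ℝ)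
    (x : (EuclideanSpace ℝ (Fin 3))) : zoom u a T ℓ s x = c⁻¹ • zoom u a T (c * ℓ) (s / c ^ 2) (c⁻¹ • x) := by
  have h := zoom_mul u a T ℓ c (s / c ^ 2) (c⁻¹ • x)
  have hs : c ^ 2 * (s / c ^ 2) = s := by field_simp
  have hx : c • c⁻¹ • x = x := by rw [smul_smul, mul_inv_cancel₀ hc, one_smul]
  rw [hs, hx] at h
  rw [h, smul_smul, inv_mul_cancel₀ hc, one_smul]

/-- The literal backward cylinder `Ioo (-(r^2)) 0 ×ˢ ball y r` is the tree's `parabolicCylinder r (0, y)`. [folklore] -/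
theorem Ioo_prod_ball_eq_parabolicCylinder (y : (EuclideanSpace ℝ (Fin 3))) (r : ℝ) :
    (Ioo (-(r ^ 2)) 0 ×ˢ ball y r) = parabolicCylinder r ((0 : ℝ), y) := by
  show Ioo (-(r ^ 2)) 0 ×ˢ ball y r = Ioo (0 - r ^ 2) 0 ×ˢ ball y r
  rw [zero_sub]

/-- Backward parabolic cylinders are measurable. [folklore] -/
theorem measurableSet_parabolicCylinder' (r : ℝ) (z : ℝ × (EuclideanSpace ℝ (Fin 3))) :
    MeasurableSet (parabolicCylinder r z) :=
  measurableSet_Ioo.prod measurableSet_ball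

/-- A cylinder `Q_r(0, y)` lies in `Q_R(0)` once `r² ≤ R²` and `|y| + r ≤ R`. -/
theorem parabolicCylinder_subset_zero {y : (EuclideanSpace ℝ (Fin 3))} {r R : ℝ} (hr : r ^ 2 ≤ R ^ 2)
    (hyR : ‖y‖ + r ≤ R) : parabolicCylinder r ((0 : ℝ), y) ⊆ parabolicCylinder R (0 : ℝ × (EuclideanSpace ℝ (Fin 3))) := by
  intro w hw
  rw [mem_parabolicCylinder] at hw ⊢
  obtain ⟨⟨h1, h2⟩, h3⟩ := hw
  simp only [Prod.fst_zero, Prod.snd_zero] at h1 h2 h3 ⊢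
  refine ⟨⟨by linarith, h2⟩, ?_⟩
  calc dist w.2 0 ≤ dist w.2 y + dist y 0 := dist_triangle _ _ _
    _ < r + ‖y‖ := by rw [dist_zero_right]; linarith
    _ ≤ R := by linarith

end UnitNormalisation

end Summit.NavierStokesRegularity.NavierStokesRegularity.Cruxes.ScarEnvelopeTypeI.ZoomDictionary
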